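import Literature.MathematicalPhysics.QuantumFieldTheory.Federbush1986.ModeAnalyticityLatticeSums

/-!
# Federbush–Williamson, *A phase cell approach to Yang–Mills theory. II. Analysis of a mode* (J. Math. Phys. **28**
# (1987) 1416–1419) [FederbushWilliamson1987PhaseCellII] — (5.3)–(5.5): the typed bracket `⟨1/p_j²⟩` SPLITS as
# `r₀ e_j/(p² p_j²)`, `e_j = 1 + p²D_j`, and the mode satisfies the polynomial identity (★) behind (5.5)

statement-level skeleton of published theorems with citation tags; proofs where landed; nothing here is a claim about
the Yang–Mills mass gap

PDF held: Deep-Blue scan `run/shared/lean/pub/pub-balaban/t4/b2b-balaban-t4-lit2/pdf/fedwill1987-jmp28-II.pdf`, page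
renders `…/b2b-balaban-t4-lit2/g7/fw1987II/fedwill1987-jmp28-II-p001…p004-x2.png` (read as images this session).

WHAT IS REPRODUCED (cell `lit-balaban`, Phase-2 proof seat p04 gen 5, SKELETON row **F2.Thm3.1**; HOME
`run/shared/lean/pub/lit-balaban/lit-balaban-p04/`; GAPS.md §G-F2-01).  Third support file of the kernel refutation of
Theorem 3.1 p. 1417.  Printed objects: `r₀(p) = ∏_i |(e^{−ip_i} − 1)/p_i|²` (5.4), in its analytic extension and
PATCHED through `p_i = 0` (`phiM`, `phiP`, `r0`: the factors `(e^{∓iz} − 1)/z` as `dslope`s of `e^{∓iz}` at `0`,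
analytic everywhere — *"we have already used the analyticity in 𝒟_L of r_L, p₁f̄₁⁻¹, and r₀⁻¹"*, p. 1418);
the prefactor `−r_L f̄₁⁻¹ = Φ(p)/p₁` of (5.1) with `Φ(p) = (i/(2π)²)(−e^{−ip₁})∏_{k≠1}(e^{−ip_k}−1)/p_k` (`Phi`,
`prefactor_eq`: *"we may remove the factor −r_L and replace f̄₁⁻¹ by p₁⁻¹"*); `e_j = 1 + p²D_j` (5.3)/(5.7) (`E`), the
numerator `N = p₄²e₂e₃ + p₃²e₂e₄ + p₂²e₃e₄` and the denominator `Σ_kp_k²∏_{j≠k}e_j` of (5.5), regrouped EXACTLY as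
`p²(1 + ĝ)` with the `g` of (6.11)/(6.14) written as a polynomial in `p²` and the `D_j` (`Nn`, `Q0…Q3`, `ghat`,
`den_eq`).  PROVED (kernel, no `sorry`): **`invSqBracket_eq`** — at every `p` of the ball `‖p‖ < 1/2` with all
`p_j ≠ 0` and `p² ≠ 0` the TYPED bracket `ModeAnalyticity.invSqBracket j p` (r17's `tsum` over `ℤ⁴`, (1.4)) equals
`r₀(p)·e_j(p)/(p²·p_j²)` — this is (5.3), obtained by splitting off the `n = 0` term; **`main_identity`** (★) — at
such `p` (with `e^{ip₁} ≠ 1`, `1 + p² ≠ 0`):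
`Φ·(N·e₁·(1+p²)^s + p₁²(1+ĝ)) = p²·r₀·(1+ĝ)·e₁·(1+p²)^s · A^N_1(p)`, i.e. (5.5) `r₀a₁ = N/Den + p₁²/(p²e₁(1+p²)^s)`
cleared of denominators, for the TYPED mode `ModeAnalyticity.AN s 0` (print's `A^N_1`; (2.1)–(2.5), (5.1)–(5.2));
analyticity of `Φ`, `r₀`, `e_j`, `N`, `ĝ` on the ball, the non-vanishing of `r₀`, `e_j`, `1 + ĝ` there
(`‖e_j − 1‖ ≤ 1/12`, `‖ĝ‖ ≤ 1/2`, from `norm_D_le`) and of `Φ` at the points used by the refutation.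
The refutation is assembled in `ModeAnalyticityThm31Refutation`.  D-0026: no named fact.
-/

noncomputable section

namespace Literature.MathematicalPhysics.QuantumFieldTheory.Federbush1986

namespace ModeAnalyticityBracketSplit

open ModeAnalyticity ModeAnalyticityLatticeSums Complex Filter Topology Finset Metric
open scoped BigOperators Real

/-! ## The patched one-variable factors `(e^{∓iz} − 1)/z` -/

/-- `φ₋(z) = (e^{−iz} − 1)/z`, patched at `z = 0` with its limit `−i` (a `dslope`).
[cite: FederbushWilliamson1987PhaseCellII, (1.2), (1.7) p. 1416; (5.4) p. 1418] -/
def phiM (z : ℂ) : ℂ := dslope (fun w => exp (-I * w)) 0 z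

/-- `φ₊(z) = (e^{iz} − 1)/z`, patched at `z = 0` with its limit `i`. [cite: FederbushWilliamson1987PhaseCellII, (1.5)
p. 1416; (5.4) p. 1418] -/
def phiP (z : ℂ) : ℂ := dslope (fun w => exp (I * w)) 0 z

/-- (plumbing) [cite: FederbushWilliamson1987PhaseCellII, (5.4) p. 1418] -/
theorem phiM_of_ne {z : ℂ} (hz : z ≠ 0) : phiM z = (exp (-I * z) - 1) / z := by
  unfold phiM; rw [dslope_of_ne _ hz, slope_def_field]; simp

/-- (plumbing) [cite: FederbushWilliamson1987PhaseCellII, (5.4) p. 1418] -/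
theorem phiP_of_ne {z : ℂ} (hz : z ≠ 0) : phiP z = (exp (I * z) - 1) / z := by
  unfold phiP; rw [dslope_of_ne _ hz, slope_def_field]; simp

/-- (plumbing) [cite: FederbushWilliamson1987PhaseCellII, (5.4) p. 1418] -/
theorem phiM_zero : phiM 0 = -I := by
  unfold phiM; rw [dslope_same]
  have h := ((hasDerivAt_id (0 : ℂ)).const_mul (-I)).cexp
  simp only [id, mul_zero, Complex.exp_zero, mul_one, one_mul] at h
  exact h.deriv

/-- (plumbing) [cite: FederbushWilliamson1987PhaseCellII, (5.4) p. 1418] -/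
theorem phiP_zero : phiP 0 = I := by
  unfold phiP; rw [dslope_same]
  have h := ((hasDerivAt_id (0 : ℂ)).const_mul I).cexp
  simp only [id, mul_zero, Complex.exp_zero, mul_one, one_mul] at h
  exact h.deriv

/-- `dslope (w ↦ e^{cw}) 0` is entire. [folklore] -/
private theorem analyticAt_dslope_exp_mul (c z : ℂ) : AnalyticAt ℂ (dslope (fun w => exp (c * w)) 0) z := by
  have hf : ∀ w, AnalyticAt ℂ (fun w => exp (c * w)) w := fun w =>
    analyticAt_cexp.comp (analyticAt_const.mul analyticAt_id)
  by_cases hz : z = 0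
  · subst hz
    obtain ⟨q, hq⟩ := hf 0
    exact hq.has_fpower_series_dslope_fslope.analyticAt
  · have heq : (fun w => (exp (c * w) - exp (c * 0)) / (w - 0)) =ᶠ[𝓝 z] dslope (fun w => exp (c * w)) 0 := by
      filter_upwards [isOpen_ne.mem_nhds hz] with w hw
      rw [dslope_of_ne _ hw, slope_def_field]
    refine AnalyticAt.congr ?_ heq
    exact ((hf z).sub analyticAt_const).div (analyticAt_id.sub analyticAt_const) (by simpa using hz)

/-- `φ₋` is analytic on all of `ℂ` (*"the analyticity … of r_L, p₁f̄₁⁻¹, r₀⁻¹"*). [cite: FederbushWilliamson1987PhaseCellII,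
§V p. 1418] -/
theorem analyticAt_phiM (z : ℂ) : AnalyticAt ℂ phiM z := analyticAt_dslope_exp_mul (-I) z

/-- `φ₊` is analytic on all of `ℂ`. [cite: FederbushWilliamson1987PhaseCellII, §V p. 1418] -/
theorem analyticAt_phiP (z : ℂ) : AnalyticAt ℂ phiP z := analyticAt_dslope_exp_mul I z

/-- If `‖z‖ < 1`, `z ≠ 0` and `‖c‖ = 1` then `c·z ≠ n·(2πi)`: the non-zero elements of `2πiℤ` have norm `≥ 2π`. [folklore] -/
private theorem mul_I_ne_of_norm_lt {z : ℂ} (hz : ‖z‖ < 1) (h0 : z ≠ 0) (n : ℤ) (c : ℂ) (hc : ‖c‖ = 1) :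
    c * z ≠ (n : ℂ) * (2 * π * I) := by
  intro h
  have hn := congrArg (fun w : ℂ => ‖w‖) h
  simp only [norm_mul, hc, one_mul, Complex.norm_intCast, Complex.norm_I, mul_one, Complex.norm_ofNat,
    Complex.norm_real, Real.norm_eq_abs, abs_of_pos Real.pi_pos] at hn
  by_cases hn0 : n = 0
  · subst hn0
    simp only [Int.cast_zero, abs_zero, zero_mul] at hn
    exact h0 (norm_eq_zero.mp hn)
  · have h1 : (1 : ℝ) ≤ |(n : ℝ)| := by rw [← Int.cast_abs]; exact_mod_cast Int.one_le_abs hn0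
    nlinarith [Real.pi_gt_three]

/-- `φ₋(z) ≠ 0` for `‖z‖ < 1` (zeros of `e^{−iz} − 1` lie in `2πℤ`). [cite: FederbushWilliamson1987PhaseCellII, §V p. 1418] -/
theorem phiM_ne_zero {z : ℂ} (hz : ‖z‖ < 1) : phiM z ≠ 0 := by
  by_cases h0 : z = 0
  · subst h0; rw [phiM_zero]; simp [Complex.I_ne_zero]
  · rw [phiM_of_ne h0]
    refine div_ne_zero ?_ h0
    intro h
    have h1 : exp (-I * z) = 1 := by rwa [sub_eq_zero] at h
    obtain ⟨n, hn⟩ := Complex.exp_eq_one_iff.mp h1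
    exact absurd hn (mul_I_ne_of_norm_lt hz h0 n (-I) (by simp))

/-- `φ₊(z) ≠ 0` for `‖z‖ < 1`. [cite: FederbushWilliamson1987PhaseCellII, §V p. 1418] -/
theorem phiP_ne_zero {z : ℂ} (hz : ‖z‖ < 1) : phiP z ≠ 0 := by
  by_cases h0 : z = 0
  · subst h0; rw [phiP_zero]; exact Complex.I_ne_zero
  · rw [phiP_of_ne h0]
    refine div_ne_zero ?_ h0
    intro h
    have h1 : exp (I * z) = 1 := by rwa [sub_eq_zero] at h
    obtain ⟨n, hn⟩ := Complex.exp_eq_one_iff.mp h1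
    exact absurd hn (mul_I_ne_of_norm_lt hz h0 n I (by simp))

/-! ## `r₀` (5.4) and the prefactor `Φ` of (5.1), patched -/

/-- `r₀(p) = ∏_i φ₋(p_i)φ₊(p_i)` — the analytic extension of (5.4) `∏_i |(e^{−ip_i}−1)/p_i|²`, patched through `p_i = 0`.
[cite: FederbushWilliamson1987PhaseCellII, (5.4) p. 1418] -/
def r0 (p : Momentum) : ℂ := ∏ i, phiM (p i) * phiP (p i)

/-- `Φ(p) = (i/(2π)²)(−e^{−ip₁})φ₋(p₂)φ₋(p₃)φ₋(p₄)`, so that `−r_L f̄₁⁻¹ = Φ/p₁` (print's indices; Lean's `0…3`).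
[cite: FederbushWilliamson1987PhaseCellII, (1.7) p. 1416, (5.1)–(5.2) p. 1417–1418] -/
def Phi (p : Momentum) : ℂ := I / (2 * π) ^ 2 * (-exp (-I * p 0)) * (phiM (p 1) * phiM (p 2) * phiM (p 3))

/-- Coordinate projections are analytic. [folklore] -/
private theorem analyticAt_apply (i : Fin 4) (p : Momentum) : AnalyticAt ℂ (fun q : Momentum => q i) p :=
  (ContinuousLinearMap.proj (R := ℂ) (φ := fun _ : Fin 4 => ℂ) i).analyticAt p

/-- `p ↦ φ₋(p_i)` is analytic. [folklore] -/
private theorem analyticAt_phiM_apply (i : Fin 4) (p : Momentum) : AnalyticAt ℂ (fun q : Momentum => phiM (q i)) p :=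
  AnalyticAt.comp (f := fun q : Momentum => q i) (analyticAt_phiM (p i)) (analyticAt_apply i p)

/-- `p ↦ φ₊(p_i)` is analytic. [folklore] -/
private theorem analyticAt_phiP_apply (i : Fin 4) (p : Momentum) : AnalyticAt ℂ (fun q : Momentum => phiP (q i)) p :=
  AnalyticAt.comp (f := fun q : Momentum => q i) (analyticAt_phiP (p i)) (analyticAt_apply i p)

/-- `r₀` is analytic on `ℂ⁴`. [cite: FederbushWilliamson1987PhaseCellII, §V p. 1418] -/
theorem analyticAt_r0 (p : Momentum) : AnalyticAt ℂ r0 p := by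
  have : r0 = fun q => (phiM (q 0) * phiP (q 0)) * (phiM (q 1) * phiP (q 1)) * (phiM (q 2) * phiP (q 2)) *
      (phiM (q 3) * phiP (q 3)) := by
    funext q; simp [r0, Fin.prod_univ_four]
  rw [this]
  exact ((((analyticAt_phiM_apply 0 p).mul (analyticAt_phiP_apply 0 p)).mul
    ((analyticAt_phiM_apply 1 p).mul (analyticAt_phiP_apply 1 p))).mul
    ((analyticAt_phiM_apply 2 p).mul (analyticAt_phiP_apply 2 p))).mul
    ((analyticAt_phiM_apply 3 p).mul (analyticAt_phiP_apply 3 p))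

/-- `Φ` is analytic on `ℂ⁴`. [cite: FederbushWilliamson1987PhaseCellII, §V p. 1418] -/
theorem analyticAt_Phi (p : Momentum) : AnalyticAt ℂ Phi p := by
  unfold Phi
  refine (analyticAt_const.mul ?_).mul
    (((analyticAt_phiM_apply 1 p).mul (analyticAt_phiM_apply 2 p)).mul (analyticAt_phiM_apply 3 p))
  exact (analyticAt_cexp.comp (analyticAt_const.mul (analyticAt_apply 0 p))).neg

/-- `r₀(p) ≠ 0` on the ball `‖p‖ < 1/2`. [cite: FederbushWilliamson1987PhaseCellII, §V p. 1418] -/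
theorem r0_ne_zero {p : Momentum} (hp : p ∈ U) : r0 p ≠ 0 := by
  unfold r0
  refine Finset.prod_ne_zero_iff.mpr fun i _ => mul_ne_zero ?_ ?_
  · exact phiM_ne_zero ((norm_apply_lt_of_mem_U hp i).trans (by norm_num))
  · exact phiP_ne_zero ((norm_apply_lt_of_mem_U hp i).trans (by norm_num))

/-- At a point with all `p_i ≠ 0`: `r₀(p)·∏_i p_i² = ∏_i (e^{−ip_i}−1)(e^{ip_i}−1)` (the un-patched (5.4)).
[cite: FederbushWilliamson1987PhaseCellII, (5.4) p. 1418] -/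
theorem r0_mul_prod_sq {p : Momentum} (hp : ∀ i, p i ≠ 0) :
    r0 p * ∏ i, (p i) ^ 2 = ∏ i, (exp (-I * p i) - 1) * (exp (I * p i) - 1) := by
  unfold r0
  rw [← Finset.prod_mul_distrib]
  refine Finset.prod_congr rfl fun i _ => ?_
  have hpi := hp i
  rw [phiM_of_ne hpi, phiP_of_ne hpi]
  field_simp

/-- **The prefactor of (5.1)**: `−r_L f̄₁⁻¹ = Φ(p)/p₁` whenever all `p_k ≠ 0` and `e^{ip₁} ≠ 1` (*"we may remove the factor
−r_L and replace f̄₁⁻¹ by p₁⁻¹"*). [cite: FederbushWilliamson1987PhaseCellII, (5.1)–(5.2) p. 1417–1418] -/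
theorem prefactor_eq {p : Momentum} (hp : ∀ i, p i ≠ 0) (hf : exp (I * p 0) ≠ 1) :
    -rL p * (fbar p 0)⁻¹ = Phi p / p 0 := by
  have hfb : fbar p 0 ≠ 0 := by unfold fbar; exact sub_ne_zero.mpr hf
  have hkey : exp (-I * p 0) - 1 = -exp (-I * p 0) * (exp (I * p 0) - 1) := by
    have : exp (-I * p 0) * exp (I * p 0) = 1 := by rw [← Complex.exp_add]; simp
    linear_combination this
  unfold rL Phi fbar
  rw [Fin.prod_univ_four]
  rw [← phiM_of_ne (hp 1), ← phiM_of_ne (hp 2), ← phiM_of_ne (hp 3), hkey]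
  have hπ : (2 * (π : ℂ)) ^ 2 ≠ 0 := pow_ne_zero _ (mul_ne_zero two_ne_zero (by exact_mod_cast Real.pi_ne_zero))
  unfold fbar at hfb
  field_simp

/-! ## `e_j`, `N`, `ĝ` and their analyticity / non-vanishing on the ball -/

/-- `e_j(p) = 1 + p²·D_j(p)` ((5.3), (5.7): `e_j = 1 + δ_j`, `δ_j = p²D_j`). [cite: FederbushWilliamson1987PhaseCellII,
(5.3), (5.7) p. 1418] -/
def E (j : Fin 4) (p : Momentum) : ℂ := 1 + csq p * D j p

/-- The numerator of (5.5): `N = p₄²e₂e₃ + p₃²e₂e₄ + p₂²e₃e₄` (Lean indices `3,1,2 / 2,1,3 / 1,2,3`).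
[cite: FederbushWilliamson1987PhaseCellII, (5.5) p. 1418] -/
def Nn (p : Momentum) : ℂ := (p 3) ^ 2 * E 1 p * E 2 p + (p 2) ^ 2 * E 1 p * E 3 p + (p 1) ^ 2 * E 2 p * E 3 p

/-- `Q₁ = [∏_{j≠1}(1 + p²D_j) − 1]/p²` as a polynomial in `p²`, `D_j` (the `k = 1` summand of (6.14) divided by `p_1²`).
[cite: FederbushWilliamson1987PhaseCellII, (6.14) p. 1418] -/
def Q0 (p : Momentum) : ℂ := (D 1 p + D 2 p + D 3 p) + csq p * (D 1 p * D 2 p + D 1 p * D 3 p + D 2 p * D 3 p)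
  + csq p ^ 2 * (D 1 p * D 2 p * D 3 p)
/-- `Q₂`, idem with `k = 2`. [cite: FederbushWilliamson1987PhaseCellII, (6.14) p. 1418] -/
def Q1 (p : Momentum) : ℂ := (D 0 p + D 2 p + D 3 p) + csq p * (D 0 p * D 2 p + D 0 p * D 3 p + D 2 p * D 3 p)
  + csq p ^ 2 * (D 0 p * D 2 p * D 3 p)
/-- `Q₃`, idem with `k = 3`. [cite: FederbushWilliamson1987PhaseCellII, (6.14) p. 1418] -/
def Q2 (p : Momentum) : ℂ := (D 0 p + D 1 p + D 3 p) + csq p * (D 0 p * D 1 p + D 0 p * D 3 p + D 1 p * D 3 p)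
  + csq p ^ 2 * (D 0 p * D 1 p * D 3 p)
/-- `Q₄`, idem with `k = 4`. [cite: FederbushWilliamson1987PhaseCellII, (6.14) p. 1418] -/
def Q3 (p : Momentum) : ℂ := (D 0 p + D 1 p + D 2 p) + csq p * (D 0 p * D 1 p + D 0 p * D 2 p + D 1 p * D 2 p)
  + csq p ^ 2 * (D 0 p * D 1 p * D 2 p)

/-- `ĝ = Σ_k p_k² Q_k` — the `g` of (6.11)/(6.14) (so that `Σ_kp_k²∏_{j≠k}e_j = p²(1 + ĝ)`).
[cite: FederbushWilliamson1987PhaseCellII, (6.11), (6.14) p. 1418] -/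
def ghat (p : Momentum) : ℂ := (p 0) ^ 2 * Q0 p + (p 1) ^ 2 * Q1 p + (p 2) ^ 2 * Q2 p + (p 3) ^ 2 * Q3 p

/-- (plumbing) `p² = p₁² + p₂² + p₃² + p₄²`. [cite: FederbushWilliamson1987PhaseCellII, (1.4) p. 1416] -/
theorem csq_eq (p : Momentum) : csq p = (p 0) ^ 2 + (p 1) ^ 2 + (p 2) ^ 2 + (p 3) ^ 2 := by
  simp [csq, Fin.sum_univ_four]

/-- **The denominator of (5.5) regrouped**: `Σ_kp_k²∏_{j≠k}e_j = p²·(1 + ĝ)` ((6.11): `p²(1+g)`).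
[cite: FederbushWilliamson1987PhaseCellII, (5.5), (6.11), (6.14) p. 1418] -/
theorem den_eq (p : Momentum) :
    (p 0) ^ 2 * E 1 p * E 2 p * E 3 p + (p 1) ^ 2 * E 0 p * E 2 p * E 3 p + (p 2) ^ 2 * E 0 p * E 1 p * E 3 p
      + (p 3) ^ 2 * E 0 p * E 1 p * E 2 p = csq p * (1 + ghat p) := by
  simp only [E, ghat, Q0, Q1, Q2, Q3, csq_eq]
  ring

/-- (plumbing) `‖p²‖ ≤ 1` on the ball. [cite: FederbushWilliamson1987PhaseCellII, §V p. 1418] -/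
theorem norm_csq_le {p : Momentum} (hp : p ∈ U) : ‖csq p‖ ≤ 1 := by
  rw [csq_eq]
  have h : ∀ i, ‖(p i) ^ 2‖ ≤ 1 / 4 := fun i => by
    rw [norm_pow]
    have h1 := (norm_apply_lt_of_mem_U hp i).le
    have h2 := norm_nonneg (p i)
    nlinarith
  calc ‖(p 0) ^ 2 + (p 1) ^ 2 + (p 2) ^ 2 + (p 3) ^ 2‖
      ≤ ‖(p 0) ^ 2‖ + ‖(p 1) ^ 2‖ + ‖(p 2) ^ 2‖ + ‖(p 3) ^ 2‖ := norm_add₄_le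
    _ ≤ 1 / 4 + 1 / 4 + 1 / 4 + 1 / 4 := by gcongr <;> exact h _
    _ = 1 := by norm_num

/-- `‖e_j − 1‖ ≤ 1/12` on the ball, hence `e_j ≠ 0` there ((6.3): *"e₁(p) is invertible in 𝒟_L"*, locally).
[cite: FederbushWilliamson1987PhaseCellII, (6.3), (6.8) p. 1418] -/
theorem norm_E_sub_one_le {p : Momentum} (hp : p ∈ U) (j : Fin 4) : ‖E j p - 1‖ ≤ 1 / 12 := by
  unfold E
  rw [add_sub_cancel_left, norm_mul]
  calc ‖csq p‖ * ‖D j p‖ ≤ 1 * (1 / 12) :=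
        mul_le_mul (norm_csq_le hp) (norm_D_le hp j) (norm_nonneg _) zero_le_one
    _ = 1 / 12 := one_mul _

/-- `e_j ≠ 0` on the ball. [cite: FederbushWilliamson1987PhaseCellII, (6.3) p. 1418] -/
theorem E_ne_zero {p : Momentum} (hp : p ∈ U) (j : Fin 4) : E j p ≠ 0 := by
  intro h
  have := norm_E_sub_one_le hp j
  rw [h, zero_sub, norm_neg, norm_one] at this
  norm_num at this

/-- Bound `‖Q‖ ≤ 1/2` on the ball for the generic shape of the `Q_k`. [folklore] -/
private theorem norm_Q_le {p : Momentum} (hp : p ∈ U) {a b c : Fin 4} :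
    ‖(D a p + D b p + D c p) + csq p * (D a p * D b p + D a p * D c p + D b p * D c p)
      + csq p ^ 2 * (D a p * D b p * D c p)‖ ≤ 1 / 2 := by
  have ha := norm_D_le hp a; have hb := norm_D_le hp b; have hc := norm_D_le hp c
  have hs := norm_csq_le hp
  have h0a := norm_nonneg (D a p); have h0b := norm_nonneg (D b p); have h0c := norm_nonneg (D c p)
  have h0s := norm_nonneg (csq p)
  calc _ ≤ ‖D a p + D b p + D c p‖ + ‖csq p * (D a p * D b p + D a p * D c p + D b p * D c p)‖
          + ‖csq p ^ 2 * (D a p * D b p * D c p)‖ := norm_add₃_le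
    _ ≤ (‖D a p‖ + ‖D b p‖ + ‖D c p‖) + ‖csq p‖ * (‖D a p‖ * ‖D b p‖ + ‖D a p‖ * ‖D c p‖ + ‖D b p‖ * ‖D c p‖)
          + ‖csq p‖ ^ 2 * (‖D a p‖ * ‖D b p‖ * ‖D c p‖) := by
        gcongr
        · exact norm_add₃_le
        · rw [norm_mul]; gcongr
          exact (norm_add₃_le).trans (by rw [norm_mul, norm_mul, norm_mul])
        · rw [norm_mul, norm_pow, norm_mul, norm_mul]
    _ ≤ (1/12 + 1/12 + 1/12) + 1 * (1/12 * (1/12) + 1/12 * (1/12) + 1/12 * (1/12))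
          + 1 ^ 2 * (1/12 * (1/12) * (1/12)) := by gcongr
    _ ≤ 1 / 2 := by norm_num

/-- `‖ĝ‖ ≤ 1/2` on the ball, hence `1 + ĝ ≠ 0` ((6.13): *"(1 + g)⁻¹ is analytic"*, locally).
[cite: FederbushWilliamson1987PhaseCellII, (6.13) p. 1418] -/
theorem norm_ghat_le {p : Momentum} (hp : p ∈ U) : ‖ghat p‖ ≤ 1 / 2 := by
  have h : ∀ i, ‖(p i) ^ 2‖ ≤ 1 / 4 := fun i => by
    rw [norm_pow]
    have h1 := (norm_apply_lt_of_mem_U hp i).le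
    have h2 := norm_nonneg (p i)
    nlinarith
  have q0 : ‖Q0 p‖ ≤ 1 / 2 := norm_Q_le hp
  have q1 : ‖Q1 p‖ ≤ 1 / 2 := norm_Q_le hp
  have q2 : ‖Q2 p‖ ≤ 1 / 2 := norm_Q_le hp
  have q3 : ‖Q3 p‖ ≤ 1 / 2 := norm_Q_le hp
  have h0 := h 0; have h1 := h 1; have h2 := h 2; have h3 := h 3
  unfold ghat
  calc _ ≤ ‖(p 0) ^ 2 * Q0 p‖ + ‖(p 1) ^ 2 * Q1 p‖ + ‖(p 2) ^ 2 * Q2 p‖ + ‖(p 3) ^ 2 * Q3 p‖ := norm_add₄_le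
    _ ≤ 1/4 * (1/2) + 1/4 * (1/2) + 1/4 * (1/2) + 1/4 * (1/2) := by
        simp only [norm_mul]
        gcongr
    _ = 1 / 2 := by norm_num

/-- `1 + ĝ ≠ 0` on the ball. [cite: FederbushWilliamson1987PhaseCellII, (6.13) p. 1418] -/
theorem one_add_ghat_ne_zero {p : Momentum} (hp : p ∈ U) : 1 + ghat p ≠ 0 := by
  intro h
  have h1 : ghat p = -1 := by linear_combination h
  have := norm_ghat_le hp
  rw [h1, norm_neg, norm_one] at this
  norm_num at this

/-- (plumbing) `p ↦ p²` is differentiable. [cite: FederbushWilliamson1987PhaseCellII, (1.4) p. 1416] -/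
theorem differentiable_csq : Differentiable ℂ (csq : Momentum → ℂ) := by
  have : (csq : Momentum → ℂ) = fun p => (p 0) ^ 2 + (p 1) ^ 2 + (p 2) ^ 2 + (p 3) ^ 2 := funext csq_eq
  rw [this]
  fun_prop

/-- `e_j` is holomorphic on the ball ((6.1)). [cite: FederbushWilliamson1987PhaseCellII, (6.1) p. 1418] -/
theorem differentiableOn_E (j : Fin 4) : DifferentiableOn ℂ (E j) U := by
  unfold E
  exact (differentiableOn_const 1).add (differentiable_csq.differentiableOn.mul (differentiableOn_D j))

/-- `N` is holomorphic on the ball. [cite: FederbushWilliamson1987PhaseCellII, (5.5), (6.1) p. 1418] -/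
theorem differentiableOn_Nn : DifferentiableOn ℂ Nn U := by
  unfold Nn
  have hp : ∀ i, DifferentiableOn ℂ (fun p : Momentum => (p i) ^ 2) U := fun i =>
    ((differentiable_apply i).pow 2).differentiableOn
  exact ((((hp 3).mul (differentiableOn_E 1)).mul (differentiableOn_E 2)).add
    (((hp 2).mul (differentiableOn_E 1)).mul (differentiableOn_E 3))).add
    (((hp 1).mul (differentiableOn_E 2)).mul (differentiableOn_E 3))

/-- Holomorphy on the ball of the generic shape of the `Q_k`. [folklore] -/
private theorem differentiableOn_Qabc (a b c : Fin 4) : DifferentiableOn ℂ (fun p : Momentum =>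
    (D a p + D b p + D c p) + csq p * (D a p * D b p + D a p * D c p + D b p * D c p)
      + csq p ^ 2 * (D a p * D b p * D c p)) U := by
  have ha := differentiableOn_D a; have hb := differentiableOn_D b; have hc := differentiableOn_D c
  have hs := differentiable_csq.differentiableOn (s := U)
  exact (((ha.add hb).add hc).add (hs.mul (((ha.mul hb).add (ha.mul hc)).add (hb.mul hc)))).add
    ((hs.pow 2).mul ((ha.mul hb).mul hc))

/-- `ĝ` is holomorphic on the ball ((6.12)–(6.13) context). [cite: FederbushWilliamson1987PhaseCellII, (6.14) p. 1418] -/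
theorem differentiableOn_ghat : DifferentiableOn ℂ ghat U := by
  have hp : ∀ i, DifferentiableOn ℂ (fun p : Momentum => (p i) ^ 2) U := fun i =>
    ((differentiable_apply i).pow 2).differentiableOn
  have h0 : DifferentiableOn ℂ Q0 U := differentiableOn_Qabc 1 2 3
  have h1 : DifferentiableOn ℂ Q1 U := differentiableOn_Qabc 0 2 3
  have h2 : DifferentiableOn ℂ Q2 U := differentiableOn_Qabc 0 1 3
  have h3 : DifferentiableOn ℂ Q3 U := differentiableOn_Qabc 0 1 2
  unfold ghat
  exact ((((hp 0).mul h0).add ((hp 1).mul h1)).add ((hp 2).mul h2)).add ((hp 3).mul h3)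

/-! ## (5.3): the typed bracket splits as `r₀ e_j/(p² p_j²)` -/

/-- (plumbing) with all `p_i ≠ 0`, `ratio_i = p_i²/(p_i + 2πn_i)²` for every `i` (also when `n_i = 0`).
[cite: FederbushWilliamson1987PhaseCellII, (6.6)–(6.7) p. 1418] -/
theorem ratio_eq_div {p : Momentum} (hp : ∀ i, p i ≠ 0) (n : Idx) (i : Fin 4) :
    ratio n p i = (p i) ^ 2 / (shift p n i) ^ 2 := by
  by_cases h : n i = 0
  · rw [ratio_of_eq h]
    have : shift p n i = p i := by rw [shift_apply, h]; simp
    rw [this, div_self (pow_ne_zero _ (hp i))]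
  · exact ratio_of_ne h p

/-- (plumbing) all lattice denominators are non-zero at such `p`. [cite: FederbushWilliamson1987PhaseCellII, (1.4) p. 1416] -/
theorem shift_ne_zero' {p : Momentum} (hU : p ∈ U) (hp : ∀ i, p i ≠ 0) (n : Idx) (i : Fin 4) : shift p n i ≠ 0 := by
  by_cases h : n i = 0
  · have : shift p n i = p i := by rw [shift_apply, h]; simp
    rw [this]; exact hp i
  · exact shift_ne_zero hU h

/-- The `n`-th term of the typed bracket `⟨1/p_j²⟩` (1.4). [cite: FederbushWilliamson1987PhaseCellII, (1.4) p. 1416] -/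
def bterm (j : Fin 4) (p : Momentum) (n : Idx) : ℂ :=
  (1 / csq (shift p n)) * (∏ i, (exp (-I * p i) - 1) * (exp (I * p i) - 1) / (shift p n i) ^ 2) *
    (1 / (shift p n j) ^ 2)

/-- (plumbing) the typed bracket is the `tsum` of `bterm`. [cite: FederbushWilliamson1987PhaseCellII, (1.4), (1.17) p. 1416–1417] -/
theorem invSqBracket_eq_tsum (j : Fin 4) (p : Momentum) : invSqBracket j p = ∑' n : Idx, bterm j p n := rfl

/-- For `n ≠ 0` the term is `(r₀/p_j²)·termD_j(n,p)` (the `n ≠ 0` terms of (5.3) regrouped as in (6.5)).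
[cite: FederbushWilliamson1987PhaseCellII, (5.3), (6.5) p. 1418] -/
theorem bterm_eq_of_ne {p : Momentum} (hU : p ∈ U) (hp : ∀ i, p i ≠ 0) (j : Fin 4) {n : Idx} (hn : n ≠ 0) :
    bterm j p n = r0 p / (p j) ^ 2 * termD j n p := by
  have hq : ∀ i, shift p n i ≠ 0 := shift_ne_zero' hU hp n
  have hc : csq (shift p n) ≠ 0 := csq_shift_ne_zero hU hn
  unfold bterm termD
  rw [Finset.prod_div_distrib, ← r0_mul_prod_sq hp]
  simp only [ratio_eq_div hp, Fin.prod_univ_four]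
  have h0 := hq 0; have h1 := hq 1; have h2 := hq 2; have h3 := hq 3
  have hp0 := hp 0; have hp1 := hp 1; have hp2 := hp 2; have hp3 := hp 3; have hpj := hp j; have hqj := hq j
  field_simp

/-- The `n = 0` term is `r₀/(p² p_j²)`. [cite: FederbushWilliamson1987PhaseCellII, (5.3) p. 1418] -/
theorem bterm_zero {p : Momentum} (hp : ∀ i, p i ≠ 0) (hc : csq p ≠ 0) (j : Fin 4) :
    bterm j p 0 = r0 p / (csq p * (p j) ^ 2) := by
  have hs : ∀ i, shift p 0 i = p i := fun i => by rw [shift_apply]; simp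
  have hs' : shift p 0 = p := funext hs
  unfold bterm
  rw [hs', Finset.prod_div_distrib, ← r0_mul_prod_sq hp]
  simp only [Fin.prod_univ_four]
  have hp0 := hp 0; have hp1 := hp 1; have hp2 := hp 2; have hp3 := hp 3; have hpj := hp j
  field_simp

/-- The equivalence between the two presentations of the non-zero lattice vectors. [folklore] -/
private def nzEquiv : NZ ≃ {x : Idx // x ∉ ({0} : Finset Idx)} :=
  Equiv.subtypeEquivRight fun x => by simp

/-- Summability of the typed bracket series at such `p`. [cite: FederbushWilliamson1987PhaseCellII, (1.4) p. 1416] -/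
theorem summable_bterm {p : Momentum} (hU : p ∈ U) (hp : ∀ i, p i ≠ 0) (j : Fin 4) : Summable (bterm j p) := by
  have h1 : Summable fun n : NZ => r0 p / (p j) ^ 2 * termD j n.1 p := (summable_termD hU j).mul_left _
  have h2 : Summable fun n : NZ => bterm j p n.1 :=
    h1.congr fun n => (bterm_eq_of_ne hU hp j n.2).symm
  have h3 : Summable fun x : {x : Idx // x ∉ ({0} : Finset Idx)} => bterm j p x.1 :=
    (nzEquiv.summable_iff (f := fun x : {x : Idx // x ∉ ({0} : Finset Idx)} => bterm j p x.1)).mp h2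
  exact (Finset.summable_compl_iff ({0} : Finset Idx)).mp h3

/-- **(5.3), for the TYPED bracket**: `⟨1/p_j²⟩(p) = r₀(p)·e_j(p)/(p²·p_j²)` at every `p` of the ball with all `p_i ≠ 0`
and `p² ≠ 0` (split off `n = 0`; the rest is `(r₀/p_j²)·D_j`). [cite: FederbushWilliamson1987PhaseCellII, (5.3) p. 1418] -/
theorem invSqBracket_eq {p : Momentum} (hU : p ∈ U) (hp : ∀ i, p i ≠ 0) (hc : csq p ≠ 0) (j : Fin 4) :
    invSqBracket j p = r0 p * E j p / (csq p * (p j) ^ 2) := by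
  rw [invSqBracket_eq_tsum]
  have hsum := summable_bterm hU hp j
  rw [← hsum.sum_add_tsum_subtype_compl {0}, Finset.sum_singleton, bterm_zero hp hc j]
  have e1 : ∑' x : {x : Idx // x ∉ ({0} : Finset Idx)}, bterm j p x.1 = ∑' n : NZ, bterm j p n.1 :=
    (nzEquiv.tsum_eq (fun x : {x : Idx // x ∉ ({0} : Finset Idx)} => bterm j p x.1)).symm
  have e2 : ∑' n : NZ, bterm j p n.1 = ∑' n : NZ, r0 p / (p j) ^ 2 * termD j n.1 p :=
    tsum_congr fun n => bterm_eq_of_ne hU hp j n.2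
  rw [e1, e2, tsum_mul_left]
  change r0 p / (csq p * (p j) ^ 2) + r0 p / (p j) ^ 2 * D j p = r0 p * E j p / (csq p * (p j) ^ 2)
  unfold E
  field_simp

/-! ## (★): the mode identity (5.5) cleared of denominators -/

/-- (plumbing) the determinant `𝒟` (1.18) expanded. [cite: FederbushWilliamson1987PhaseCellII, (1.18) p. 1417] -/
theorem scrD_expand (p : Momentum) : scrD p = 16 * (invSqBracket 1 p * invSqBracket 2 p * invSqBracket 3 p
    + invSqBracket 0 p * invSqBracket 2 p * invSqBracket 3 p + invSqBracket 0 p * invSqBracket 1 p * invSqBracket 3 p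
    + invSqBracket 0 p * invSqBracket 1 p * invSqBracket 2 p) := by
  unfold scrD
  have e0 : (Finset.univ : Finset (Fin 4)).erase 0 = {1, 2, 3} := by decide
  have e1 : (Finset.univ : Finset (Fin 4)).erase 1 = {0, 2, 3} := by decide
  have e2 : (Finset.univ : Finset (Fin 4)).erase 2 = {0, 1, 3} := by decide
  have e3 : (Finset.univ : Finset (Fin 4)).erase 3 = {0, 1, 2} := by decide
  rw [Fin.sum_univ_four, e0, e1, e2, e3]
  simp [Finset.prod_insert, Finset.prod_singleton]
  ring

/-- (plumbing) `l₁` (2.2). [cite: FederbushWilliamson1987PhaseCellII, (2.2) p. 1417] -/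
theorem l_zero (p : Momentum) : l 0 p = invSqBracket 1 p * invSqBracket 2 p + invSqBracket 1 p * invSqBracket 3 p
    + invSqBracket 2 p * invSqBracket 3 p := by
  simp [l]

/-- **(★) — (5.5) for the typed mode, cleared of denominators**: at every `p` of the ball with all `p_i ≠ 0`, `p² ≠ 0`,
`e^{ip₁} ≠ 1`, `1 + p² ≠ 0`:
`Φ·(N·e₁·(1+p²)^s + p₁²(1+ĝ)) = p²·r₀·(1+ĝ)·e₁·(1+p²)^s·A^N_1(p)`.
[cite: FederbushWilliamson1987PhaseCellII, (5.1)–(5.5) p. 1417–1418] -/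
theorem main_identity (s : ℕ) {p : Momentum} (hU : p ∈ U) (hp : ∀ i, p i ≠ 0) (hc : csq p ≠ 0)
    (hf : exp (I * p 0) ≠ 1) (h1 : 1 + csq p ≠ 0) :
    Phi p * (Nn p * E 0 p * (1 + csq p) ^ s + (p 0) ^ 2 * (1 + ghat p))
      = csq p * r0 p * (1 + ghat p) * E 0 p * (1 + csq p) ^ s * AN s 0 p := by
  have hB0 := invSqBracket_eq hU hp hc 0
  have hB1 := invSqBracket_eq hU hp hc 1
  have hB2 := invSqBracket_eq hU hp hc 2
  have hB3 := invSqBracket_eq hU hp hc 3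
  have hr := r0_ne_zero hU
  have hE0 := E_ne_zero hU 0; have hE1 := E_ne_zero hU 1; have hE2 := E_ne_zero hU 2; have hE3 := E_ne_zero hU 3
  have hg := one_add_ghat_ne_zero hU
  have hden := den_eq p
  have hp0 := hp 0; have hp1 := hp 1; have hp2 := hp 2; have hp3 := hp 3
  have hcs : (1 + csq p) ^ s ≠ 0 := pow_ne_zero _ h1
  -- `𝒟 = 16·r₀³·(1+ĝ)/( (p²)²·∏ p_i² )` and `l₁ = r₀²·N/((p²)²·p₂²p₃²p₄²)`
  have hS : scrD p = 16 * (r0 p ^ 3 * (csq p * (1 + ghat p)) / (csq p ^ 3 * (p 0 * p 1 * p 2 * p 3) ^ 2)) := by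
    rw [scrD_expand, hB0, hB1, hB2, hB3, ← hden]
    field_simp
  have hL : l 0 p = r0 p ^ 2 * Nn p / (csq p ^ 2 * (p 1 * p 2 * p 3) ^ 2) := by
    rw [l_zero, hB1, hB2, hB3]
    unfold Nn
    field_simp
  unfold AN Aprime X
  rw [hS, hL, prefactor_eq hp hf, hB0]
  field_simp

end ModeAnalyticityBracketSplit

end Literature.MathematicalPhysics.QuantumFieldTheory.Federbush1986
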